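import Mathlib
import Summits.HodgeConjecture.FermatCycles.HodgeFermatDigitLemma
import Summits.HodgeConjecture.FermatCycles.HodgeFermatDecodingC

/-!
# PROPOSITION L5 (`tables/KR-FREE.md` §4) — part 1: the model and the fibre counts at 5 (`HodgeFermat/PropL5.lean`; HF-G21a)

Tree copy (part 1 of 2) of the module `HodgeFermat/PropL5.lean` of the sibling cell's standalone package
`run/shared/lean/pub/pub-hodgefermat/lean/HodgeFermat/` (613 lines, sha256 `31e91f78ccd85872…`), source lines 37–324 (§0 the standalone model `InH`/`SameType`/`rsum` of this module, §§1–3: residues, LEMMA N at 5 (Z3)/(Z1)/(U) counts).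
Filed by cell `pub-hfermat`, seat prover-1 gen-3, on the COORDINATOR KEEPER RULING of 2026-08-25 (gem sweep H1: take the
off-gate kernel theorem `thmFstar` through the gate) — here THEOREM F* of `tables/DPRIME-THEOREM.md` §9 IN FULL, i.e.
PROPOSITION D′(3N) and the descent (`HodgeFermat/PropDPrimeNFinal.lean`, GATE HF-G34), the last off-gate form of THEOREM F*
(its first two forms, `DecodingFinal.thmFstar` = F* at the prime levels and `ThmFstarNFinal.thmFstar` = F*(3N), landed on
2026-08-25 as `HodgeFermatThmFstar.lean` / `HodgeFermatThmFstarN.lean`, seats prover-1 gen-0 / gen-2); this file is one link of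
the import closure of `PropDPrimeNFinal.propDprime` (the sibling's KR-free chain: THEOREM L, COROLLARY M, THEOREM D6,
THEOREM U⁺, THEOREM KR6, THEOREM Z3U) on top of those landed chains.  The source module is the sibling's hub-checked module of
record (pub-hodgefermat `CERT.md` l.867, GATE HF-G21a); its declarations are copied VERBATIM.
Deviations from the source module, exhaustively: the `import` lines (tree modules `Summits.HodgeConjecture.FermatCycles.
HodgeFermat*` instead of `HodgeFermat.*`); this module docstring; DEDUP (pre-empting the gate's `dedup.landed`): the source's `lemma mod_eq_of_repr` (l.58–62) restates `HodgeFermat.KRFree.mod_eq_of_repr` of `HodgeFermatDigitLemma.lean` VERBATIM (the sibling's `PropZ5.lean` l.47 hides one of the two for this reason) and is DELETED — inside `namespace HodgeFermat.KRFree.PropL5` the name resolves to the `DigitLemma` lemma with no further change (extra import); the source's `lemma not_dvd_mul_of_coprime` (l.262–265) restates the landed `HodgeFermat.KRFree.Decoding.unit_mul_not_dvd` (`HodgeFermatDecodingC.lean`) VERBATIM up to the names of bound variables and is DELETED, re-bound by the added line `open HodgeFermat.KRFree.Decoding renaming unit_mul_not_dvd → not_dvd_mul_of_coprime` (extra import)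 so that its use sites (source l.288, 289, 563–565) stay byte-identical; the file ends at source l.324 with an `end` line (part 2 = `HodgeFermatPropL5B.lean`).  NOTE: this module carries its OWN copies of `InH`/`SameType`/`rsum` (namespace `HodgeFermat.KRFree.PropL5`, source §0), bridged to `LemmaN`'s in `HodgeFermatBridge.lean` — verbatim, not unified.
Every other line — in particular every declaration's statement and proof — is byte-identical to the source.
HONEST FRAMING: explicit algebraic cycles for specific Hodge classes on Fermat/Delsarte varieties; residual open instances
listed; no claim on general Hodge.  (This file is arithmetic of CM types / finite combinatorics / analytic number theory
of the sibling's KR-free programme; it claims nothing about cycles.)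

The source module's docstring (PropL5.lean l.3–35), verbatim:

## PROPOSITION L5 (`tables/KR-FREE.md` §4) — kernel-checked end-to-end for every level (build hodge-fermat, generation 21)

Koblitz–Rohrlich (Canad. J. Math. 30 (1978), p. 1197, Case 3 with `p = 5 ∥ N`, `r = 5`) omit this case "in the
interest of brevity"; `tables/KR-FREE.md` §4 (PROPOSITION L5) supplies the argument, and generation 20 kernel-checked
its inner identity (`L5Fibre.lean`: the fibre of `H_T` over `5̄`).  This file proves the PROPOSITION ITSELF, as a
statement about CM types, for EVERY `n > 20` with `5 ∤ n` — no squarefreeness or parity hypothesis is needed (the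
levels `N = 5n ≤ 100` prime to 6 are covered by the facts F35 … F95 of `KRFreeFacts.lean`):

> `N = 5n`; `T = (x₁, x₂, x₃)` with `N ∣ x₁ + x₂ + x₃`, `5 ∣ x₁`, `gcd(x₁, n) = 1`, `5 ∤ x₂ x₃` (pattern Z1 at 5 with
> unit cofactor); `T' = (y₁, y₂, y₃)` with `N ∣ y₁ + y₂ + y₃`, `5 ∤ y₁ y₂ y₃` (pattern U at 5).  Then
> `H_T ∩ (ℤ/N)ˣ ≠ H_{T'} ∩ (ℤ/N)ˣ`  (`theorem propL5`, stated as `SameType (5n) T T' → False`).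

Model (shared with `PropZ5.lean`).  `InH N (a, b, c) t :↔ ⟨ta⟩_N + ⟨tb⟩_N < N` (`t ∈ H_T`, i.e. carry 1 — the `Prop`
form of `inType` of `KRFreeFacts.lean`: `inType N T t = decide (InH N T t)`); `SameType N T T' :↔ ∀ t` coprime to
`N`, `t ∈ H_T ↔ t ∈ H_{T'}`; `rsum N T t := ⟨ta⟩_N + ⟨tb⟩_N + ⟨tc⟩_N` (`= N · carry` when `N ∣ a + b + c`).

Proof (= §4, with LEMMA N (U) replaced by the bound it is used for).  `U_bound`: for `T'` all of whose entries are
prime to 5 and any unit `t̄₀` of `ℤ/n`, NOT all four unit lifts `t₀ + jn` lie in `H_{T'}` (`N_{T'}(t̄₀) ≤ 3`): for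
`5 ∤ x` the five residues `⟨(t₀ + jn)x⟩_N`, `j = 0,…,4`, are `n·B_j + ⟨t₀x⟩_n` with `{B_j} = {0,…,4}` (`lift_repr`,
`lift_ne`, `lift_sum`: their sum is `5⟨t₀x⟩_n + 10n`), the lift divisible by 5 has residue sum `5·(n or 2n)`
(`rsum_five_mul`, `rsum_small_cases`), and four carries equal to 1 would make the total over the fibre too small.
On the Z1 side: after the first normalisation `x₁ ↦ 5` (`norm1`, a CRT unit) the carry of `T̄ = T mod n` at `1̄` is
1 or 2 (`carry_one_cases`); carry 1 puts the whole fibre over `1̄` into `H_T` (`Z1_fibre_one`); carry 2 means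
`⟨x₂⟩_n + ⟨x₃⟩_n = 2n − 5`, and after the second normalisation (`norm2`, a unit `≡ 1 mod n`) `T = (5, N − a, N − b)`,
`a + b = 5`, whose fibre over `5̄` lies in `H_T` (`fibre_sum`, `fibre_inH`, `hj_unit` — generation 20's
`L5Fibre.lean`, copied verbatim so that this file is self-contained).  Either way `H_T = H_{T'}` on units contradicts
`U_bound` for `T'`.

Lean 4 + Mathlib (toolchain of the package); `import Mathlib` only; no `sorry`, no `native_decide`;
`#print axioms propL5` at the end (`[propext, Classical.choice, Quot.sound]`).  Companions: `PropZ5.lean` (pattern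
(Z1, Z1) at 5, which imports this file), `DigitLemma.lean`, `L5Fibre.lean`, `KRFreeFacts.lean`.
-/

set_option autoImplicit false

namespace HodgeFermat.KRFree.PropL5

open HodgeFermat.KRFree.Decoding renaming unit_mul_not_dvd → not_dvd_mul_of_coprime

/-! ## The model: CM-type membership, same type -/

/-- `t ∈ H_T` for `T = (a, b, c)` of level `N`: carry 1, i.e. `⟨ta⟩_N + ⟨tb⟩_N < N`
(the `Prop` form of `KRFree.inType` of `KRFreeFacts.lean`: `inType N T t = decide (InH N T t)`) -/
def InH (N : ℕ) (T : ℕ × ℕ × ℕ) (t : ℕ) : Prop :=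
  (t * T.1) % N + (t * T.2.1) % N < N

/-- `T` and `T'` have the same CM type: `H_T ∩ (ℤ/N)ˣ = H_{T'} ∩ (ℤ/N)ˣ` -/
def SameType (N : ℕ) (T T' : ℕ × ℕ × ℕ) : Prop :=
  ∀ t, Nat.Coprime t N → (InH N T t ↔ InH N T' t)

/-- the residue sum `⟨ta⟩_N + ⟨tb⟩_N + ⟨tc⟩_N` (`= N · carry`) -/
def rsum (N : ℕ) (T : ℕ × ℕ × ℕ) (t : ℕ) : ℕ :=
  (t * T.1) % N + (t * T.2.1) % N + (t * T.2.2) % N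

/-! ## Basic lemmas -/


/-- `H_T` depends only on the residues of the (first two) entries -/
lemma inH_congr {N a b c a' b' c' t : ℕ} (ha : a ≡ a' [MOD N]) (hb : b ≡ b' [MOD N]) :
    InH N (a, b, c) t ↔ InH N (a', b', c') t := by
  unfold InH
  simp only
  rw [(ha.mul_left t : t * a ≡ t * a' [MOD N]), (hb.mul_left t : t * b ≡ t * b' [MOD N])]

/-- scaling: `t ∈ H_{uT} ↔ tu ∈ H_T` -/
lemma inH_scale (N u a b c t : ℕ) :
    InH N (u * a, u * b, u * c) t ↔ InH N (a, b, c) (t * u) := by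
  unfold InH
  simp only [mul_assoc]

/-- a coincidence is preserved by scaling with a unit: `H_T = H_{T'} → H_{uT} = H_{uT'}` -/
lemma sameType_scale {N u : ℕ} {T T' : ℕ × ℕ × ℕ} (hu : Nat.Coprime u N) (h : SameType N T T') :
    SameType N (u * T.1, u * T.2.1, u * T.2.2) (u * T'.1, u * T'.2.1, u * T'.2.2) := by
  intro t ht
  rw [inH_scale, inH_scale]
  exact h (t * u) (Nat.Coprime.mul_left ht hu)

/-- same type is preserved when entries are replaced by congruent ones -/
lemma sameType_congr_left {N a b c a' b' c' : ℕ} {T' : ℕ × ℕ × ℕ} (ha : a ≡ a' [MOD N])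
    (hb : b ≡ b' [MOD N]) (h : SameType N (a, b, c) T') : SameType N (a', b', c') T' := by
  intro t ht
  rw [← inH_congr ha hb]
  exact h t ht

/-- three residues in `[1, N-1]` with sum divisible by `N` sum to `N` or `2N` -/
lemma carry_cases {N r₁ r₂ r₃ : ℕ} (h₁ : 0 < r₁) (h₁' : r₁ < N) (h₂ : 0 < r₂) (h₂' : r₂ < N)
    (h₃ : 0 < r₃) (h₃' : r₃ < N) (hd : N ∣ r₁ + r₂ + r₃) :
    r₁ + r₂ + r₃ = N ∨ r₁ + r₂ + r₃ = 2 * N := by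
  obtain ⟨k, hk⟩ := hd
  have hk1 : 1 ≤ k := by
    by_contra h0
    have : k = 0 := by omega
    subst this; omega
  have hk2 : k ≤ 2 := by
    by_contra h3
    have : 3 ≤ k := by omega
    have : N * 3 ≤ N * k := Nat.mul_le_mul_left N this
    omega
  interval_cases k <;> omega

/-- the residue sum of `T = (x, y, z)` at `t` is divisible by `N` when `N ∣ x + y + z` -/
lemma rsum_dvd {N x y z : ℕ} (t : ℕ) (hs : N ∣ x + y + z) : N ∣ rsum N (x, y, z) t := by
  unfold rsum
  simp only
  have h : N ∣ t * x + t * y + t * z := by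
    rw [← Nat.mul_add, ← Nat.mul_add]; exact Dvd.dvd.mul_left hs t
  have h1 : t * x % N ≡ t * x [MOD N] := Nat.mod_modEq _ _
  have h2 : t * y % N ≡ t * y [MOD N] := Nat.mod_modEq _ _
  have h3 : t * z % N ≡ t * z [MOD N] := Nat.mod_modEq _ _
  exact (Nat.modEq_zero_iff_dvd.mp (((h1.add h2).add h3).trans (Nat.modEq_zero_iff_dvd.mpr h)))

/-- for a triple with `N ∣ x+y+z` and a multiplier `t` with `N ∤ tx, ty, tz`:
the residue sum is `N` (carry 1) or `2N` (carry 2) -/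
lemma rsum_cases {N x y z t : ℕ} (hN : 0 < N) (hs : N ∣ x + y + z) (hx : ¬ N ∣ t * x)
    (hy : ¬ N ∣ t * y) (hz : ¬ N ∣ t * z) :
    rsum N (x, y, z) t = N ∨ rsum N (x, y, z) t = 2 * N := by
  have hd := rsum_dvd t hs
  unfold rsum at hd ⊢
  simp only at hd ⊢
  refine carry_cases ?_ (Nat.mod_lt _ hN) ?_ (Nat.mod_lt _ hN) ?_ (Nat.mod_lt _ hN) hd
  · exact Nat.pos_of_ne_zero (fun h => hx (Nat.dvd_of_mod_eq_zero h))
  · exact Nat.pos_of_ne_zero (fun h => hy (Nat.dvd_of_mod_eq_zero h))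
  · exact Nat.pos_of_ne_zero (fun h => hz (Nat.dvd_of_mod_eq_zero h))

/-- membership in `H_T` ⟺ residue sum `= N` (carry 1) -/
lemma inH_iff_rsum {N x y z t : ℕ} (hN : 0 < N) (hs : N ∣ x + y + z) (hx : ¬ N ∣ t * x)
    (hy : ¬ N ∣ t * y) (hz : ¬ N ∣ t * z) :
    InH N (x, y, z) t ↔ rsum N (x, y, z) t = N := by
  have hc := rsum_cases hN hs hx hy hz
  have h3 : t * z % N < N := Nat.mod_lt _ hN
  have h3' : 0 < t * z % N := Nat.pos_of_ne_zero (fun h => hz (Nat.dvd_of_mod_eq_zero h))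
  unfold InH rsum at *
  simp only at *
  omega

/-! ## LEMMA N (U) at the prime 5, as a bound: not all four unit lifts of `t̄₀` lie in `H_T`

Level `N = 5n`, `5 ∤ n`.  The five residues of `ℤ/N` above `t̄₀ ∈ ℤ/n` are `t₀ + jn`, `j = 0,…,4`; exactly one is
divisible by 5.  For an entry `x` with `5 ∤ x` the residues `R_j = ⟨(t₀ + jn)x⟩_N` are `n·B_j + ⟨t₀x⟩_n` with
`{B_0,…,B_4} = {0,…,4}`, so `Σ_j R_j = 5⟨t₀x⟩_n + 10n`.  Summing over the three entries of a triple all of whose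
entries are prime to 5 shows that the four unit lifts cannot all have carry 1. -/

/-- `R_j = n·B + ⟨t₀x⟩_n` with `B ≤ 4` -/
lemma lift_repr (n t₀ x j : ℕ) (hn : 0 < n) :
    ∃ B, B ≤ 4 ∧ (t₀ + j * n) * x % (5 * n) = n * B + t₀ * x % n := by
  refine ⟨(t₀ + j * n) * x % (5 * n) / n, ?_, ?_⟩
  · have h : (t₀ + j * n) * x % (5 * n) < 5 * n := Nat.mod_lt _ (by omega)
    have := (Nat.div_lt_iff_lt_mul hn).mpr h
    omega
  · have hmod : (t₀ + j * n) * x % (5 * n) % n = t₀ * x % n := by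
      rw [Nat.mod_mul_left_mod]
      have e : (t₀ + j * n) * x = t₀ * x + (j * x) * n := by ring
      rw [e, Nat.add_mul_mod_self_right]
    have := Nat.div_add_mod ((t₀ + j * n) * x % (5 * n)) n
    rw [hmod] at this
    exact this.symm

/-- exactly one lift is divisible by 5: uniqueness -/
lemma nonunit_unique {n t₀ j j' : ℕ} (h5n : ¬ 5 ∣ n) (hj : j ≤ 4) (hj' : j' ≤ 4)
    (h1 : 5 ∣ t₀ + j * n) (h2 : 5 ∣ t₀ + j' * n) : j = j' := by
  rcases le_total j j' with hle | hle
  · obtain ⟨d, rfl⟩ := Nat.exists_eq_add_of_le hle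
    have e : t₀ + (j + d) * n = (t₀ + j * n) + d * n := by ring
    rw [e, Nat.dvd_add_right h1] at h2
    rcases (Nat.Prime.dvd_mul Nat.prime_five).mp h2 with h | h
    · have : d = 0 := by omega
      omega
    · exact absurd h h5n
  · obtain ⟨d, rfl⟩ := Nat.exists_eq_add_of_le hle
    have e : t₀ + (j' + d) * n = (t₀ + j' * n) + d * n := by ring
    rw [e, Nat.dvd_add_right h2] at h1
    rcases (Nat.Prime.dvd_mul Nat.prime_five).mp h1 with h | h
    · have : d = 0 := by omega
      omega
    · exact absurd h h5n

/-- exactly one lift is divisible by 5: existence -/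
lemma nonunit_exists (n t₀ : ℕ) (h5n : ¬ 5 ∣ n) : ∃ j₀, j₀ ≤ 4 ∧ 5 ∣ t₀ + j₀ * n := by
  have hco : Nat.Coprime n 5 :=
    Nat.coprime_comm.mp ((Nat.Prime.coprime_iff_not_dvd Nat.prime_five).mpr h5n)
  obtain ⟨m, hm, hmn⟩ := Nat.exists_mul_mod_eq_of_coprime (5 - t₀ % 5) hco (by norm_num)
  refine ⟨m, by omega, Nat.dvd_of_mod_eq_zero ?_⟩
  have h1 : (t₀ + m * n) % 5 = (t₀ % 5 + (n * m) % 5) % 5 := by rw [Nat.add_mod, mul_comm m n]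
  rw [h1, hmn]
  have : t₀ % 5 < 5 := Nat.mod_lt _ (by norm_num)
  omega

/-- the residues of the five lifts at an entry prime to 5 are pairwise distinct -/
lemma lift_ne {n t₀ x j j' : ℕ} (hn : 0 < n) (h5x : ¬ 5 ∣ x) (hjj' : j < j') (hj' : j' ≤ 4) :
    (t₀ + j * n) * x % (5 * n) ≠ (t₀ + j' * n) * x % (5 * n) := by
  intro h
  obtain ⟨d, rfl⟩ := Nat.exists_eq_add_of_le hjj'.le
  have e : (t₀ + (j + d) * n) * x = (t₀ + j * n) * x + (d * x) * n := by ring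
  rw [e] at h
  have h0 : (t₀ + j * n) * x + 0 ≡ (t₀ + j * n) * x + (d * x) * n [MOD 5 * n] := by
    rw [Nat.add_zero]; exact h
  have h1 : 0 ≡ (d * x) * n [MOD 5 * n] := Nat.ModEq.add_left_cancel' _ h0
  have h2 : 5 * n ∣ (d * x) * n := (Nat.modEq_zero_iff_dvd.mp h1.symm)
  have h3 : 5 ∣ d * x := Nat.dvd_of_mul_dvd_mul_right hn h2
  rcases (Nat.Prime.dvd_mul Nat.prime_five).mp h3 with h4 | h4
  · have : 0 < d := by omega
    have : d ≤ 4 := by omega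
    omega
  · exact h5x h4

/-- `Σ_{j=0}^{4} ⟨(t₀ + jn)x⟩_{5n} = 5⟨t₀x⟩_n + 10n` for `5 ∤ x` -/
lemma lift_sum (n t₀ x : ℕ) (hn : 0 < n) (h5x : ¬ 5 ∣ x) :
    (t₀ + 0 * n) * x % (5 * n) + (t₀ + 1 * n) * x % (5 * n) + (t₀ + 2 * n) * x % (5 * n)
      + (t₀ + 3 * n) * x % (5 * n) + (t₀ + 4 * n) * x % (5 * n) = 5 * (t₀ * x % n) + 10 * n := by
  obtain ⟨B0, b0, e0⟩ := lift_repr n t₀ x 0 hn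
  obtain ⟨B1, b1, e1⟩ := lift_repr n t₀ x 1 hn
  obtain ⟨B2, b2, e2⟩ := lift_repr n t₀ x 2 hn
  obtain ⟨B3, b3, e3⟩ := lift_repr n t₀ x 3 hn
  obtain ⟨B4, b4, e4⟩ := lift_repr n t₀ x 4 hn
  have d01 : B0 ≠ B1 := fun hb => lift_ne (j := 0) (j' := 1) hn h5x (by norm_num) (by norm_num) (by rw [e0, e1, hb])
  have d02 : B0 ≠ B2 := fun hb => lift_ne (j := 0) (j' := 2) hn h5x (by norm_num) (by norm_num) (by rw [e0, e2, hb])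
  have d03 : B0 ≠ B3 := fun hb => lift_ne (j := 0) (j' := 3) hn h5x (by norm_num) (by norm_num) (by rw [e0, e3, hb])
  have d04 : B0 ≠ B4 := fun hb => lift_ne (j := 0) (j' := 4) hn h5x (by norm_num) (by norm_num) (by rw [e0, e4, hb])
  have d12 : B1 ≠ B2 := fun hb => lift_ne (j := 1) (j' := 2) hn h5x (by norm_num) (by norm_num) (by rw [e1, e2, hb])
  have d13 : B1 ≠ B3 := fun hb => lift_ne (j := 1) (j' := 3) hn h5x (by norm_num) (by norm_num) (by rw [e1, e3, hb])
  have d14 : B1 ≠ B4 := fun hb => lift_ne (j := 1) (j' := 4) hn h5x (by norm_num) (by norm_num) (by rw [e1, e4, hb])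
  have d23 : B2 ≠ B3 := fun hb => lift_ne (j := 2) (j' := 3) hn h5x (by norm_num) (by norm_num) (by rw [e2, e3, hb])
  have d24 : B2 ≠ B4 := fun hb => lift_ne (j := 2) (j' := 4) hn h5x (by norm_num) (by norm_num) (by rw [e2, e4, hb])
  have d34 : B3 ≠ B4 := fun hb => lift_ne (j := 3) (j' := 4) hn h5x (by norm_num) (by norm_num) (by rw [e3, e4, hb])
  have hperm : B0 + B1 + B2 + B3 + B4 = 10 := by omega
  zify at e0 e1 e2 e3 e4 hperm ⊢
  linear_combination e0 + e1 + e2 + e3 + e4 + (n : ℤ) * hperm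

/-- the lift divisible by 5, `t₀ + j₀n = 5t₁`, has `⟨5t₁·x⟩_{5n} = 5⟨t₁x⟩_n` -/
lemma rsum_five_mul (n t₁ x y z : ℕ) :
    rsum (5 * n) (x, y, z) (5 * t₁) = 5 * rsum n (x, y, z) t₁ := by
  unfold rsum
  simp only [mul_assoc, Nat.mul_mod_mul_left]
  ring

/-- the residue sum modulo `n` is `0`, `n` or `2n` -/
lemma rsum_small_cases {n x y z : ℕ} (t : ℕ) (hn : 0 < n) (hs : n ∣ x + y + z) :
    rsum n (x, y, z) t = 0 ∨ rsum n (x, y, z) t = n ∨ rsum n (x, y, z) t = 2 * n := by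
  obtain ⟨k, hk⟩ := rsum_dvd t hs
  have h1 : t * x % n < n := Nat.mod_lt _ hn
  have h2 : t * y % n < n := Nat.mod_lt _ hn
  have h3 : t * z % n < n := Nat.mod_lt _ hn
  have hlt : rsum n (x, y, z) t < 3 * n := by unfold rsum; simp only; omega
  have hk3 : k < 3 := by
    by_contra h
    have : n * 3 ≤ n * k := Nat.mul_le_mul_left n (by omega)
    omega
  interval_cases k <;> omega

/-- a unit lift: coprime to `N = 5n` -/
lemma lift_coprime {n t₀ j : ℕ} (ht₀ : Nat.Coprime t₀ n) (h5 : ¬ 5 ∣ t₀ + j * n) :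
    Nat.Coprime (t₀ + j * n) (5 * n) := by
  refine Nat.Coprime.mul_right ?_ ?_
  · exact ((Nat.Prime.coprime_iff_not_dvd Nat.prime_five).mpr h5).symm
  · exact (Nat.coprime_add_mul_right_left t₀ n j).mpr ht₀

/-- **LEMMA N (U) at 5 (upper bound).**  `N = 5n`, `5 ∤ n`, `t₀` prime to `n`, `T = (x, y, z)` with
`N ∣ x + y + z` and `5 ∤ xyz`.  Then some unit lift `t₀ + jn` (`j ≤ 4`, `5 ∤ t₀ + jn`) is NOT in `H_T`:
the fibre count `N_T(t̄₀)` is at most 3. -/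
theorem U_bound (n t₀ x y z : ℕ) (hn : 0 < n) (h5n : ¬ 5 ∣ n) (ht₀ : Nat.Coprime t₀ n)
    (hs : 5 * n ∣ x + y + z) (hx : ¬ 5 ∣ x) (hy : ¬ 5 ∣ y) (hz : ¬ 5 ∣ z) :
    ∃ j, j ≤ 4 ∧ ¬ 5 ∣ t₀ + j * n ∧ ¬ InH (5 * n) (x, y, z) (t₀ + j * n) := by
  by_contra H
  have H' : ∀ j, j ≤ 4 → ¬ 5 ∣ t₀ + j * n → InH (5 * n) (x, y, z) (t₀ + j * n) := by
    intro j hj h5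
    by_contra hin
    exact H ⟨j, hj, h5, hin⟩
  have hN : 0 < 5 * n := by omega
  have hxN : ¬ 5 * n ∣ x := fun h => hx (Nat.dvd_trans ⟨n, rfl⟩ h)
  have hyN : ¬ 5 * n ∣ y := fun h => hy (Nat.dvd_trans ⟨n, rfl⟩ h)
  have hzN : ¬ 5 * n ∣ z := fun h => hz (Nat.dvd_trans ⟨n, rfl⟩ h)
  obtain ⟨j₀, hj₀, hj₀5⟩ := nonunit_exists n t₀ h5n
  -- the four unit lifts have carry 1
  have hunit : ∀ j, j ≤ 4 → j ≠ j₀ → rsum (5 * n) (x, y, z) (t₀ + j * n) = 5 * n := by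
    intro j hj hne
    have h5j : ¬ 5 ∣ t₀ + j * n := fun h => hne (nonunit_unique h5n hj hj₀ h hj₀5)
    have hco := lift_coprime ht₀ h5j
    exact (inH_iff_rsum hN hs (not_dvd_mul_of_coprime hco hxN) (not_dvd_mul_of_coprime hco hyN)
      (not_dvd_mul_of_coprime hco hzN)).mp (H' j hj h5j)
  have r0 := hunit 0 (by norm_num)
  have r1 := hunit 1 (by norm_num)
  have r2 := hunit 2 (by norm_num)
  have r3 := hunit 3 (by norm_num)
  have r4 := hunit 4 (by norm_num)
  -- the non-unit lift
  obtain ⟨t₁, ht₁⟩ := hj₀5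
  have hstar : rsum (5 * n) (x, y, z) (t₀ + j₀ * n) = 5 * rsum n (x, y, z) t₁ := by
    rw [ht₁]; exact rsum_five_mul n t₁ x y z
  -- the total over the five lifts
  have htot : rsum (5 * n) (x, y, z) (t₀ + 0 * n) + rsum (5 * n) (x, y, z) (t₀ + 1 * n)
      + rsum (5 * n) (x, y, z) (t₀ + 2 * n) + rsum (5 * n) (x, y, z) (t₀ + 3 * n)
      + rsum (5 * n) (x, y, z) (t₀ + 4 * n) = 5 * rsum n (x, y, z) t₀ + 30 * n := by
    have lx := lift_sum n t₀ x hn hx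
    have ly := lift_sum n t₀ y hn hy
    have lz := lift_sum n t₀ z hn hz
    unfold rsum; simp only; omega
  -- sizes of the two small residue sums
  have hsn : n ∣ x + y + z := Nat.dvd_trans ⟨5, by ring⟩ hs
  have hA := rsum_small_cases t₀ hn hsn
  have hAs := rsum_small_cases t₁ hn hsn
  -- if the `t₀`-sum vanishes, `n` divides all entries and the `t₁`-sum vanishes too
  have hzero : rsum n (x, y, z) t₀ = 0 → rsum n (x, y, z) t₁ = 0 := by
    intro h0
    unfold rsum at h0 ⊢; simp only at h0 ⊢
    have dx : n ∣ x := Nat.Coprime.dvd_of_dvd_mul_left ht₀.symm (Nat.dvd_of_mod_eq_zero (by omega))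
    have dy : n ∣ y := Nat.Coprime.dvd_of_dvd_mul_left ht₀.symm (Nat.dvd_of_mod_eq_zero (by omega))
    have dz : n ∣ z := Nat.Coprime.dvd_of_dvd_mul_left ht₀.symm (Nat.dvd_of_mod_eq_zero (by omega))
    have ex : t₁ * x % n = 0 := Nat.mod_eq_zero_of_dvd (Dvd.dvd.mul_left dx t₁)
    have ey : t₁ * y % n = 0 := Nat.mod_eq_zero_of_dvd (Dvd.dvd.mul_left dy t₁)
    have ez : t₁ * z % n = 0 := Nat.mod_eq_zero_of_dvd (Dvd.dvd.mul_left dz t₁)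
    omega
  interval_cases j₀ <;> omega


end HodgeFermat.KRFree.PropL5
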